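/-
Width seat `ym-line-cbag-p1-w3` (prover-ym-line-cbag-p1-w3-g10-0; own items stmt-QuantumFields-22254 / 22893 of route `ColdBoxAllGroups`
CLOSED proved).  Glue towards the TWO-SIDED six-plane DLR transfer (node `Theorems.TreeLevelLimitWitness`): the abstract law of total
covariance as an UPPER bound, with an exceptional event, a datum-dependent ceiling and datum-dependent deviations of the conditional means.
Pure probability; RECORD-type material downstream; the Yang–Mills mass gap is NOT proved by anything here.
-/
import Summits.QuantumFields.YangMills.Theorems.SixPlaneColdBoxTotalCovarianceDatumFloor

/-!
# LINE 3 `SixPlaneColdBox`, glue: the law of total covariance as an UPPER bound (exceptional event, datum ceiling, mean deviations)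

The landed one-sided DLR transfers (`BulkAllGroups`, `DensityTransferG`) bound a torus covariance `∫q − ∫h·∫k` (`h = E_ω X`, `k = E_ω Y`,
`q = E_ω(XY)` the conditional expectations given the boundary datum `ω`) from BELOW by `E_ω[Cov_ω] ≥ θ − Φ(ω)` off a rare bad event and
`Cov(h, k) ≥ −¼∫(k − h)²` (`total_covariance_lower_bound_sub_datumFloor`).  The UPPER bound needs the other half of the law of total covariance:
`Cov(h, k)` is small when the conditional means do not move much with the datum.  This file records the abstract step:

* `integral_mul_sub_sub_eq` — `∫hk − ∫h·∫k = ∫(h − a)(k − b) − (∫h − a)(∫k − b)` for any constants `a, b` (probability measure);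
* **`total_covariance_upper_bound_dev`** — on a probability space, `h, k, q` measurable with `|h|, |k| ≤ K₀`, `|q| ≤ K₀²`, `|a|, |b| ≤ K₀`,
  `E` of mass `≤ p`, `Φ, Ψ, Ψ' ≥ 0` integrable, `σ ≥ 0`; if off `E` the conditional covariance is `q − hk ≤ θ + Φ`, the conditional means deviate
  from the constants by `|h − a| ≤ Ψ ≤ σ` and `|k − b| ≤ Ψ'`, then
  `∫q − ∫h·∫k ≤ θ + ∫Φ + σ·∫Ψ' + (∫Ψ + 2K₀p)(∫Ψ' + 2K₀p) + (|θ| + 6K₀²)p`.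

Proof: pointwise `q − hk ≤ θ + Φ + (|θ| + 2K₀²)𝟙_E`, `|h − a||k − b| ≤ σΨ' + 4K₀²𝟙_E`, `|h − a| ≤ Ψ + 2K₀𝟙_E` (and the same for `k`), then
integrate and use `integral_mul_sub_sub_eq` (Durrett 2019 §4.1).  In the application (`X, Y` the six-plane cost sums at the centre of the cold box
and at its `⌈β^A⌉e₀`-translate) `Ψ ≍ β^{-1}·(kernel-mean excess)`, whose sup over crude-good data is `≍ β^{2θ/5−1}` (interior bound of the harmonic
background) and whose torus average is `≍ β^{−1−3θ}` (torus-mean excess), so `σ∫Ψ' ≪ β^{−2−8A}`.  No sorry; no definition; standard axioms.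
-/

set_option autoImplicit false

noncomputable section

open MeasureTheory

namespace Summit.QuantumFields.YangMills.Theorems.SixPlaneColdBox

/-- **Covariance through centred variables**: `∫hk − ∫h·∫k = ∫(h − a)(k − b) − (∫h − a)(∫k − b)` for any constants `a, b` under a probability
measure (`h, k, hk` integrable). [folklore] -/
theorem integral_mul_sub_sub_eq {Ω : Type*} [MeasurableSpace Ω] {μ : Measure Ω} [IsProbabilityMeasure μ] {h k : Ω → ℝ}
    (hhi : Integrable h μ) (hki : Integrable k μ) (hhki : Integrable (fun ω => h ω * k ω) μ) (a b : ℝ) :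
    (∫ ω, h ω * k ω ∂μ) - (∫ ω, h ω ∂μ) * (∫ ω, k ω ∂μ) =
      (∫ ω, (h ω - a) * (k ω - b) ∂μ) - ((∫ ω, h ω ∂μ) - a) * ((∫ ω, k ω ∂μ) - b) := by
  have e : (fun ω => (h ω - a) * (k ω - b)) = fun ω => h ω * k ω - a * k ω - b * h ω + a * b := by
    funext ω; ring
  have i1 : Integrable (fun ω => h ω * k ω - a * k ω) μ := hhki.sub (hki.const_mul a)
  have i2 : Integrable (fun ω => h ω * k ω - a * k ω - b * h ω) μ := i1.sub (hhi.const_mul b)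
  rw [e, integral_add i2 (integrable_const _), integral_sub i1 (hhi.const_mul b), integral_sub hhki (hki.const_mul a),
    integral_const_mul, integral_const_mul, integral_const, smul_eq_mul, probReal_univ, one_mul]
  ring

/-- **Law of total covariance as an UPPER bound, with an exceptional event, a datum-dependent ceiling and datum-dependent mean deviations.**
On a probability space let `h, k, q` be measurable with `|h|, |k| ≤ K₀`, `|q| ≤ K₀²` (conditional expectations of `X`, `Y`, `XY` given the
boundary datum), `a, b` constants with `|a|, |b| ≤ K₀`, `E` an event of mass `≤ p`, `Φ, Ψ, Ψ' ≥ 0` integrable and `σ ≥ 0`.  If off `E` the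
conditional covariance satisfies `q − hk ≤ θ + Φ` and the conditional means satisfy `|h − a| ≤ Ψ ≤ σ`, `|k − b| ≤ Ψ'`, then
`∫q − ∫h·∫k ≤ θ + ∫Φ + σ·∫Ψ' + (∫Ψ + 2K₀p)(∫Ψ' + 2K₀p) + (|θ| + 6K₀²)p`.  [folklore; Durrett 2019 §4.1] -/
theorem total_covariance_upper_bound_dev {Ω : Type*} [MeasurableSpace Ω] {μ : Measure Ω} [IsProbabilityMeasure μ]
    {E : Set Ω} (hE : MeasurableSet E) {h k q Φ Ψ Ψ' : Ω → ℝ} (hhm : Measurable h) (hkm : Measurable k) (hqm : Measurable q)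
    (hΦi : Integrable Φ μ) (hΨi : Integrable Ψ μ) (hΨ'i : Integrable Ψ' μ) {K₀ θ σ p a b : ℝ}
    (hhK : ∀ ω, |h ω| ≤ K₀) (hkK : ∀ ω, |k ω| ≤ K₀) (hqK : ∀ ω, |q ω| ≤ K₀ ^ 2) (ha : |a| ≤ K₀) (hb : |b| ≤ K₀)
    (hΦ0 : ∀ ω, 0 ≤ Φ ω) (hΨ0 : ∀ ω, 0 ≤ Ψ ω) (hΨ'0 : ∀ ω, 0 ≤ Ψ' ω) (hσ0 : 0 ≤ σ)
    (hup : ∀ ω, ω ∉ E → q ω - h ω * k ω ≤ θ + Φ ω)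
    (hdevh : ∀ ω, ω ∉ E → |h ω - a| ≤ Ψ ω) (hdevk : ∀ ω, ω ∉ E → |k ω - b| ≤ Ψ' ω) (hσ : ∀ ω, ω ∉ E → Ψ ω ≤ σ)
    (hμE : μ.real E ≤ p) :
    (∫ ω, q ω ∂μ) - (∫ ω, h ω ∂μ) * (∫ ω, k ω ∂μ) ≤
      θ + (∫ ω, Φ ω ∂μ) + σ * (∫ ω, Ψ' ω ∂μ) + ((∫ ω, Ψ ω ∂μ) + 2 * K₀ * p) * ((∫ ω, Ψ' ω ∂μ) + 2 * K₀ * p) +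
        (|θ| + 6 * K₀ ^ 2) * p := by
  obtain ⟨ω₁⟩ := nonempty_of_isProbabilityMeasure μ
  have hK : 0 ≤ K₀ := (abs_nonneg _).trans (hhK ω₁)
  have bdd : ∀ {f : Ω → ℝ} (C : ℝ), Measurable f → (∀ ω, |f ω| ≤ C) → Integrable f μ := fun C hf hC =>
    Integrable.of_bound hf.aestronglyMeasurable C (ae_of_all _ fun ω => by simpa [Real.norm_eq_abs] using hC ω)
  have hhkb : ∀ ω, |h ω * k ω| ≤ K₀ ^ 2 := fun ω => by
    rw [abs_mul, sq]; exact mul_le_mul (hhK ω) (hkK ω) (abs_nonneg _) hK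
  have hhi : Integrable h μ := bdd K₀ hhm hhK
  have hki : Integrable k μ := bdd K₀ hkm hkK
  have hqi : Integrable q μ := bdd _ hqm hqK
  have hhki : Integrable (fun ω => h ω * k ω) μ := bdd _ (hhm.mul hkm) hhkb
  have hE0 : 0 ≤ μ.real E := measureReal_nonneg
  have hp0 : 0 ≤ p := hE0.trans hμE
  have hindi : Integrable (fun ω => E.indicator (fun _ => (1 : ℝ)) ω) μ := (integrable_const 1).indicator hE
  have hind_int : ∫ ω, E.indicator (fun _ => (1 : ℝ)) ω ∂μ = μ.real E := by
    rw [integral_indicator_const _ hE]; simp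
  -- the centred variables
  have hda : ∀ ω, |h ω - a| ≤ 2 * K₀ := fun ω => by
    have := abs_sub (h ω) a; linarith [hhK ω, ha]
  have hdb : ∀ ω, |k ω - b| ≤ 2 * K₀ := fun ω => by
    have := abs_sub (k ω) b; linarith [hkK ω, hb]
  have hdam : Measurable fun ω => h ω - a := hhm.sub measurable_const
  have hdbm : Measurable fun ω => k ω - b := hkm.sub measurable_const
  have hdai : Integrable (fun ω => h ω - a) μ := bdd _ hdam hda
  have hdbi : Integrable (fun ω => k ω - b) μ := bdd _ hdbm hdb
  have hprodb : ∀ ω, |(h ω - a) * (k ω - b)| ≤ (2 * K₀) * (2 * K₀) := fun ω => by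
    rw [abs_mul]; exact mul_le_mul (hda ω) (hdb ω) (abs_nonneg _) (by positivity)
  have hprodi : Integrable (fun ω => (h ω - a) * (k ω - b)) μ := bdd _ (hdam.mul hdbm) hprodb
  -- Step 1: the mean of the conditional covariances
  have hstep1 : (∫ ω, q ω ∂μ) - (∫ ω, h ω * k ω ∂μ) ≤ θ + (∫ ω, Φ ω ∂μ) + (|θ| + 2 * K₀ ^ 2) * p := by
    rw [← integral_sub hqi hhki]
    have hpt : ∀ ω, q ω - h ω * k ω ≤ θ + Φ ω + (|θ| + 2 * K₀ ^ 2) * E.indicator (fun _ => (1 : ℝ)) ω := by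
      intro ω
      by_cases hω : ω ∈ E
      · rw [Set.indicator_of_mem hω, mul_one]
        have h1 := hqK ω
        have h2 := hhkb ω
        have h3 := hΦ0 ω
        have h4 := neg_abs_le θ
        rw [abs_le] at h1 h2
        linarith
      · rw [Set.indicator_of_notMem hω, mul_zero, add_zero]
        exact hup ω hω
    have hθΦ : Integrable (fun ω => θ + Φ ω) μ := (integrable_const θ).add hΦi
    have hind2 : Integrable (fun ω => (|θ| + 2 * K₀ ^ 2) * E.indicator (fun _ => (1 : ℝ)) ω) μ := hindi.const_mul _
    have hRi : Integrable (fun ω => θ + Φ ω + (|θ| + 2 * K₀ ^ 2) * E.indicator (fun _ => (1 : ℝ)) ω) μ := hθΦ.add hind2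
    calc ∫ ω, (q ω - h ω * k ω) ∂μ ≤ ∫ ω, (θ + Φ ω + (|θ| + 2 * K₀ ^ 2) * E.indicator (fun _ => (1 : ℝ)) ω) ∂μ :=
          integral_mono (hqi.sub hhki) hRi hpt
      _ = θ + (∫ ω, Φ ω ∂μ) + (|θ| + 2 * K₀ ^ 2) * μ.real E := by
          rw [integral_add hθΦ hind2, integral_add (integrable_const θ) hΦi,
            integral_const_mul, hind_int, integral_const, smul_eq_mul, probReal_univ, one_mul]
      _ ≤ θ + (∫ ω, Φ ω ∂μ) + (|θ| + 2 * K₀ ^ 2) * p := by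
          have : 0 ≤ |θ| + 2 * K₀ ^ 2 := by positivity
          nlinarith
  -- Step 2: the centred product
  have hstep2 : ∫ ω, (h ω - a) * (k ω - b) ∂μ ≤ σ * (∫ ω, Ψ' ω ∂μ) + 4 * K₀ ^ 2 * p := by
    have hpt : ∀ ω, (h ω - a) * (k ω - b) ≤ σ * Ψ' ω + 4 * K₀ ^ 2 * E.indicator (fun _ => (1 : ℝ)) ω := by
      intro ω
      have h0 := le_abs_self ((h ω - a) * (k ω - b))
      rw [abs_mul] at h0
      by_cases hω : ω ∈ E
      · rw [Set.indicator_of_mem hω, mul_one]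
        have h1 : |h ω - a| * |k ω - b| ≤ (2 * K₀) * (2 * K₀) := mul_le_mul (hda ω) (hdb ω) (abs_nonneg _) (by positivity)
        have h2 : 0 ≤ σ * Ψ' ω := mul_nonneg hσ0 (hΨ'0 ω)
        linarith
      · rw [Set.indicator_of_notMem hω, mul_zero, add_zero]
        have h1 : |h ω - a| * |k ω - b| ≤ σ * Ψ' ω :=
          mul_le_mul ((hdevh ω hω).trans (hσ ω hω)) (hdevk ω hω) (abs_nonneg _) hσ0
        linarith
    have hσΨ : Integrable (fun ω => σ * Ψ' ω) μ := hΨ'i.const_mul σ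
    have hind4 : Integrable (fun ω => 4 * K₀ ^ 2 * E.indicator (fun _ => (1 : ℝ)) ω) μ := hindi.const_mul _
    have hRi : Integrable (fun ω => σ * Ψ' ω + 4 * K₀ ^ 2 * E.indicator (fun _ => (1 : ℝ)) ω) μ := hσΨ.add hind4
    calc ∫ ω, (h ω - a) * (k ω - b) ∂μ ≤ ∫ ω, (σ * Ψ' ω + 4 * K₀ ^ 2 * E.indicator (fun _ => (1 : ℝ)) ω) ∂μ :=
          integral_mono hprodi hRi hpt
      _ = σ * (∫ ω, Ψ' ω ∂μ) + 4 * K₀ ^ 2 * μ.real E := by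
          rw [integral_add hσΨ hind4, integral_const_mul, integral_const_mul, hind_int]
      _ ≤ σ * (∫ ω, Ψ' ω ∂μ) + 4 * K₀ ^ 2 * p := by nlinarith [sq_nonneg K₀]
  -- Step 3: the means of the centred variables
  have hmean : ∀ {f Χ : Ω → ℝ} {c : ℝ}, Integrable f μ → Integrable Χ μ → (∀ ω, 0 ≤ Χ ω) → (∀ ω, |f ω - c| ≤ 2 * K₀) →
      (∀ ω, ω ∉ E → |f ω - c| ≤ Χ ω) → |(∫ ω, f ω ∂μ) - c| ≤ (∫ ω, Χ ω ∂μ) + 2 * K₀ * p := by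
    intro f Χ c hfi hΧi hΧ0 hfc hdev
    have e : (∫ ω, f ω ∂μ) - c = ∫ ω, (f ω - c) ∂μ := by
      rw [integral_sub hfi (integrable_const c), integral_const, smul_eq_mul, probReal_univ, one_mul]
    rw [e]
    have hpt : ∀ ω, ‖f ω - c‖ ≤ Χ ω + 2 * K₀ * E.indicator (fun _ => (1 : ℝ)) ω := by
      intro ω
      rw [Real.norm_eq_abs]
      by_cases hω : ω ∈ E
      · rw [Set.indicator_of_mem hω, mul_one]
        linarith [hfc ω, hΧ0 ω]
      · rw [Set.indicator_of_notMem hω, mul_zero, add_zero]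
        exact hdev ω hω
    have hind1 : Integrable (fun ω => 2 * K₀ * E.indicator (fun _ => (1 : ℝ)) ω) μ := hindi.const_mul _
    have hRi : Integrable (fun ω => Χ ω + 2 * K₀ * E.indicator (fun _ => (1 : ℝ)) ω) μ := hΧi.add hind1
    have hfci : Integrable (fun ω => f ω - c) μ := hfi.sub (integrable_const c)
    calc |∫ ω, (f ω - c) ∂μ| = ‖∫ ω, (f ω - c) ∂μ‖ := (Real.norm_eq_abs _).symm
      _ ≤ ∫ ω, ‖f ω - c‖ ∂μ := norm_integral_le_integral_norm _
      _ ≤ ∫ ω, (Χ ω + 2 * K₀ * E.indicator (fun _ => (1 : ℝ)) ω) ∂μ :=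
          integral_mono hfci.norm hRi hpt
      _ = (∫ ω, Χ ω ∂μ) + 2 * K₀ * μ.real E := by
          rw [integral_add hΧi hind1, integral_const_mul, hind_int]
      _ ≤ (∫ ω, Χ ω ∂μ) + 2 * K₀ * p := by nlinarith
  have hmh : |(∫ ω, h ω ∂μ) - a| ≤ (∫ ω, Ψ ω ∂μ) + 2 * K₀ * p := hmean hhi hΨi hΨ0 hda hdevh
  have hmk : |(∫ ω, k ω ∂μ) - b| ≤ (∫ ω, Ψ' ω ∂μ) + 2 * K₀ * p := hmean hki hΨ'i hΨ'0 hdb hdevk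
  have hΨint0 : 0 ≤ ∫ ω, Ψ ω ∂μ := integral_nonneg hΨ0
  have hΨ'int0 : 0 ≤ ∫ ω, Ψ' ω ∂μ := integral_nonneg hΨ'0
  -- Step 4: the covariance of the conditional means
  have hstep4 : (∫ ω, h ω * k ω ∂μ) - (∫ ω, h ω ∂μ) * (∫ ω, k ω ∂μ) ≤
      σ * (∫ ω, Ψ' ω ∂μ) + 4 * K₀ ^ 2 * p + ((∫ ω, Ψ ω ∂μ) + 2 * K₀ * p) * ((∫ ω, Ψ' ω ∂μ) + 2 * K₀ * p) := by
    rw [integral_mul_sub_sub_eq hhi hki hhki a b]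
    have hprod : |((∫ ω, h ω ∂μ) - a) * ((∫ ω, k ω ∂μ) - b)| ≤
        ((∫ ω, Ψ ω ∂μ) + 2 * K₀ * p) * ((∫ ω, Ψ' ω ∂μ) + 2 * K₀ * p) := by
      rw [abs_mul]
      exact mul_le_mul hmh hmk (abs_nonneg _) (by positivity)
    have h2 := neg_abs_le (((∫ ω, h ω ∂μ) - a) * ((∫ ω, k ω ∂μ) - b))
    linarith [hstep2]
  -- assemble
  have e : (∫ ω, q ω ∂μ) - (∫ ω, h ω ∂μ) * (∫ ω, k ω ∂μ) =
      ((∫ ω, q ω ∂μ) - (∫ ω, h ω * k ω ∂μ)) + ((∫ ω, h ω * k ω ∂μ) - (∫ ω, h ω ∂μ) * (∫ ω, k ω ∂μ)) := by ring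
  rw [e]
  linarith [hstep1, hstep4]

end Summit.QuantumFields.YangMills.Theorems.SixPlaneColdBox

end
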